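import Summits.Ventures.HodgeRepro2.T5HeckeGeneratorTransport

/-!
# Conjugation by a change of basis, and the size of a double coset along a group isomorphism

Tier-5 support N3 / §G-N4.2 (seat p3, gen 77). Companion of file 240: the change of basis `P` with `Pᴴ H P = J`
gives a group isomorphism `U(J) ≃* U(H)`, `g ↦ P g P⁻¹` (`conjMulEquiv`), which matches the hyperspecial
subgroups when `P` is integral (`mem_hyperspecialSubgroup_conjMulEquiv_iff`), and the number of cosets in a double
coset is invariant under any matched group isomorphism (`ncard_orbit_eq_of_mulEquiv`, T5-144's image formula) and
under an equality of subgroups (`ncard_orbit_eq_of_eq`):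

* `conjTranspose_inv_mul_mul_inv` — `Pᴴ H P = J ⇒ (P⁻¹)ᴴ J P⁻¹ = H`;
* **`conjMulEquiv`** — `U(J) ≃* U(H)` by conjugation, `conjMulEquiv_apply_coe`;
* **`mem_hyperspecialSubgroup_conjMulEquiv_iff`** — for `P ∈ GL(𝒪)`: `g ∈ K_J ↔ P g P⁻¹ ∈ K_H`;
* **`ncard_orbit_eq_of_mulEquiv`**, `ncard_orbit_eq_of_eq` — `#(K g K / K) = #(K' φ(g) K' / K')`.

§8(d): uses an L-value-free non-vanishing device: NO.
-/

open Matrix MulAction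
open Summit.Ventures.HodgeRepro2.T5UnitaryGroupForm Summit.Ventures.HodgeRepro2.T5UnitaryHeckeAdjoint
  Summit.Ventures.HodgeRepro2.T5HeckeIsomorphismTransport Summit.Ventures.HodgeRepro2.T5HeckeIsomorphismTransportCells
  Summit.Ventures.HodgeRepro2.T5HeckeGeneratorTransport

namespace Summit.Ventures.HodgeRepro2.T5HeckeConjugationTransport

section Conjugation

variable {E : Type*} [CommRing E] [StarRing E] {ι : Type*} [Fintype ι] [DecidableEq ι]

/-- `Pᴴ H P = J` gives `(P⁻¹)ᴴ J P⁻¹ = H`. -/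
theorem conjTranspose_inv_mul_mul_inv {H J : Matrix ι ι E} (P : GL ι E)
    (hP : (P : Matrix ι ι E)ᴴ * H * P = J) :
    ((P⁻¹ : GL ι E) : Matrix ι ι E)ᴴ * J * ((P⁻¹ : GL ι E) : Matrix ι ι E) = H := by
  have hPi' : (P : Matrix ι ι E) * ((P⁻¹ : GL ι E) : Matrix ι ι E) = 1 := by
    rw [← Units.val_mul, mul_inv_cancel, Units.val_one]
  rw [← hP]
  calc ((P⁻¹ : GL ι E) : Matrix ι ι E)ᴴ * ((P : Matrix ι ι E)ᴴ * H * (P : Matrix ι ι E)) *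
        ((P⁻¹ : GL ι E) : Matrix ι ι E)
      = (((P⁻¹ : GL ι E) : Matrix ι ι E)ᴴ * (P : Matrix ι ι E)ᴴ) * H *
          ((P : Matrix ι ι E) * ((P⁻¹ : GL ι E) : Matrix ι ι E)) := by
          simp only [Matrix.mul_assoc]
    _ = H := by
          rw [← Matrix.conjTranspose_mul, hPi', Matrix.conjTranspose_one, Matrix.one_mul, Matrix.mul_one]

/-- **Conjugation by a change of basis**: `Pᴴ H P = J` gives `U(J) ≃* U(H)`, `g ↦ P g P⁻¹`. -/
noncomputable def conjMulEquiv {H J : Matrix ι ι E} (P : GL ι E) (hP : (P : Matrix ι ι E)ᴴ * H * P = J) :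
    ↥(formUnitaryGroup J) ≃* ↥(formUnitaryGroup H) where
  toFun g := ⟨P * g * P⁻¹, conj_mem_formUnitaryGroup P hP g.2⟩
  invFun h := ⟨P⁻¹ * h * P, by
    have := conj_mem_formUnitaryGroup (P⁻¹) (conjTranspose_inv_mul_mul_inv P hP) h.2
    rwa [inv_inv] at this⟩
  left_inv g := Subtype.ext (by simp only [mul_assoc, inv_mul_cancel_left, inv_mul_cancel, mul_one])
  right_inv h := Subtype.ext (by simp only [mul_assoc, mul_inv_cancel_left, mul_inv_cancel, mul_one])
  map_mul' g h := Subtype.ext (by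
    simp only [Subgroup.coe_mul, mul_assoc, inv_mul_cancel_left])

/-- The underlying matrix of `conjMulEquiv P hP g` is `P g P⁻¹`. -/
theorem conjMulEquiv_apply_coe {H J : Matrix ι ι E} (P : GL ι E) (hP : (P : Matrix ι ι E)ᴴ * H * P = J)
    (g : ↥(formUnitaryGroup J)) : (conjMulEquiv P hP g : GL ι E) = P * g * P⁻¹ :=
  rfl

end Conjugation

section Hyperspecial

variable {E : Type*} [Field E] [StarRing E] {ι : Type*} [Fintype ι] [DecidableEq ι]
variable {R : Type*} [CommRing R] [Algebra R E]

/-- **An integral change of basis matches the hyperspecial subgroups**: for `P ∈ GL(𝒪)`,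
`g ∈ K_J ↔ P g P⁻¹ ∈ K_H` (the range of `GL(𝒪) → GL(E)` is a subgroup). -/
theorem mem_hyperspecialSubgroup_conjMulEquiv_iff {H J : Matrix ι ι E} (P : GL ι E)
    (hP : (P : Matrix ι ι E)ᴴ * H * P = J) (hPr : P ∈ (Matrix.GeneralLinearGroup.map (algebraMap R E)).range)
    (g : ↥(formUnitaryGroup J)) :
    g ∈ hyperspecialSubgroup R J ↔ conjMulEquiv P hP g ∈ hyperspecialSubgroup R H := by
  rw [mem_hyperspecialSubgroup_iff, mem_hyperspecialSubgroup_iff, conjMulEquiv_apply_coe]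
  constructor
  · intro hg
    exact Subgroup.mul_mem _ (Subgroup.mul_mem _ hPr hg) (Subgroup.inv_mem _ hPr)
  · intro hg
    have h : (g : GL ι E) = P⁻¹ * (P * g * P⁻¹) * P := by
      simp only [mul_assoc, inv_mul_cancel_left, inv_mul_cancel, mul_one]
    rw [h]
    exact Subgroup.mul_mem _ (Subgroup.mul_mem _ (Subgroup.inv_mem _ hPr) hg) hPr

end Hyperspecial

section Orbit

variable {G G' : Type*} [Group G] [Group G'] (φ : G ≃* G') {K : Subgroup G} {K' : Subgroup G'}

/-- **The size of a double coset is invariant under a matched group isomorphism**: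
`#(K g K / K) = #(K' φ(g) K' / K')` (T5-144's `quotientEquivOfMulEquiv_image_orbit`). -/
theorem ncard_orbit_eq_of_mulEquiv (hK : ∀ g : G, g ∈ K ↔ φ g ∈ K') (g : G) :
    (orbit K (g : G ⧸ K)).ncard = (orbit K' ((φ g : G') : G' ⧸ K')).ncard := by
  rw [← quotientEquivOfMulEquiv_image_orbit φ hK g,
    Set.ncard_image_of_injective _ (quotientEquivOfMulEquiv φ hK).injective]

/-- The size of a double coset across an equality of subgroups. -/
theorem ncard_orbit_eq_of_eq {K₁ K₂ : Subgroup G} (h : K₁ = K₂) (g : G) :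
    (orbit K₁ (g : G ⧸ K₁)).ncard = (orbit K₂ (g : G ⧸ K₂)).ncard := by
  subst h
  rfl

end Orbit

end Summit.Ventures.HodgeRepro2.T5HeckeConjugationTransport
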